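import Summits.BirchSwinnertonDyer.Rank1Residual.Additive.KatoDescentKatoRigidGroupLike
import Mathlib.NumberTheory.Padics.ProperSpace
import Mathlib.Tactic.LinearCombination
import HarnessLib

set_option autoImplicit false

/-!
# AUG engine, step 16: the TWIST LIMIT — a cluster point `β*` of the twist exponents in the compact group `ℤ_p`,
# `(1 + T)^β ≡ (1 + T)^{β′} (mod ω_k)` for `p^k ∣ β − β′`, transfer of representatives to lower levels, and the algebra of
# the level identity after the dictionary
# (seat `bsd-cm-prr-ty1` g15, cell `bsd-cm`; theorems only: no definition, no named fact, no instance, no `sorry`)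

Part 58 of the seat's kernel cut of stub 3 of the Kato–Perrin-Riou skeletons v4 (cruxes stmt-BirchSwinnertonDyer-19945 /
-19223).  In the ENDGAME for the display AUG (HOME `bsd-cm-prr-ty1/STUB3-CUT.md` §6 addendum 8) the identity (★χ) at level `n`
carries the frame-rotation twist `χ̄(a_n)`, read (E43 `read_inv_apply`) by the group-like element `(1 + T)^{β_n}`, `β_n = κ(σ_n)`,
`χ_cyc(σ_n) ≡ a_n`.  The rotations `a_n` of the two (arbitrary) frame families are NOT coherent in `n`; instead of the coherence
argument (R4) of the memo THIS FILE uses the COMPACTNESS of `ℤ_p`: the sequence `β_n` has a cluster point `β*`, and at a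
character of `Γ_k` read at a level `n ≥ k` with `p^k ∣ β_n − β*` the elements `(1 + T)^{β_n}` and `(1 + T)^{β*}` have the same
representatives modulo `ω_k` — so ONE fixed Iwasawa function serves infinitely many character points.
* §1 ★ `exists_clusterPt_pow_dvd` — for every sequence `c : ℕ → ℤ_p` there is `β*` with: for all `k, n₀` some `n ≥ n₀` has
  `p^k ∣ c n − β*` (Mathlib `PadicInt.compactSpace`, `IsCompact.tendsto_subseq`, `PadicInt.norm_le_pow_iff_mem_span_pow`);
* §2 `span_omega_le` (`(ω_n) ≤ (ω_k)` for `k ≤ n`), ★ `binomialSeries_sub_binomialSeries_mem_span` (`(1+T)^β − (1+T)^{β′} ∈ (ω_k)` for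
  `p^k ∣ β − β′`, from E37 `pow_sub_one_dvd_binomialSeries_sub_one` and Mathlib `binomialSeries_add`),
  ★ `rep_mul_binomialSeries_of_pow_dvd` (a representative of `Ψ·(1+T)^{β′}` mod `ω_n` represents `Ψ·(1+T)^{β}` mod `ω_k`);
* §3 ★ `smul_aeval_eq_aeval_of_reads` — the ALGEBRA of the level identity: from (★χ) `r_F(u−1)·(e • T₁) = r_G(u−1)·(W·T₂)` and the
  readings `p^{v₁} • T₁ = R₁(u−1)`, `p^{v₂} • T₂ = R₂(u−1)`, `W = r_a(u−1)` (E44, E43) to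
  `e • Q₁(u−1) = Q₂(u−1)` with `Q₁ = p^{v₂}·r_F·R₁`, `Q₂ = p^{v₁}·r_G·R₂·r_a ∈ ℤ_p[X]` — the shape transported by E41.
HONEST LABEL: `p`-adic bookkeeping serving the seat's AUG engine; no stub closed; nothing asserted on 19945 / 19223; no summit
statement is proved; BSD is not proved for any curve.
References: [Washington1997] §7.1–§7.2 (Λ, `(1+T)^α`, `ω_n`), §13.1; [Serre1973] Ch. II §3 (compactness of `ℤ_p`);
[Kato2004Asterisque] §13.9 (p. 230).
-/

noncomputable section

open scoped TensorProduct
open Polynomial Filter Topology PowerSeries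

namespace Summit.BirchSwinnertonDyer.Rank1Residual.Additive.PerrinRiouUnit

variable {p : ℕ} [hp : Fact p.Prime]

/-! ## §1 A cluster point of a sequence of twist exponents -/

/-- ★ **Every sequence in `ℤ_p` has a cluster point, in congruence form**: there is `β*` such that for every `k` and `n₀` some
`n ≥ n₀` has `p^k ∣ c_n − β*` (`ℤ_p` is compact). [cite: Serre1973, Ch. II §3] [cite: Washington1997, §7.1] -/
theorem exists_clusterPt_pow_dvd (c : ℕ → ℤ_[p]) :
    ∃ β : ℤ_[p], ∀ k n₀ : ℕ, ∃ n : ℕ, n₀ ≤ n ∧ (p : ℤ_[p]) ^ k ∣ c n - β := by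
  obtain ⟨β, -, φ, hφ, hlim⟩ := (isCompact_univ (X := ℤ_[p])).tendsto_subseq (x := c) (fun _ => Set.mem_univ _)
  refine ⟨β, fun k n₀ => ?_⟩
  have hε : (0 : ℝ) < (p : ℝ) ^ (-(k : ℤ)) := zpow_pos (by exact_mod_cast hp.out.pos) _
  obtain ⟨N₀, hN₀⟩ := Metric.tendsto_atTop.mp hlim _ hε
  refine ⟨φ (max N₀ n₀), le_trans (le_max_right _ _) (hφ.id_le _), ?_⟩
  have h1 : ‖c (φ (max N₀ n₀)) - β‖ ≤ (p : ℝ) ^ (-(k : ℤ)) := by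
    have := hN₀ (max N₀ n₀) (le_max_left _ _)
    rw [Function.comp_apply, dist_eq_norm] at this
    exact this.le
  rw [PadicInt.norm_le_pow_iff_mem_span_pow] at h1
  exact Ideal.mem_span_singleton.mp h1

/-! ## §2 `(1 + T)^β ≡ (1 + T)^{β′} (mod ω_k)` and transfer of representatives -/

/-- `(ω_n) ≤ (ω_k)` for `k ≤ n` (the tree's `IwasawaH1Exists.span_omega_succ_le`, iterated). [cite: Washington1997, Thm. 7.1] -/
theorem span_omega_le {k n : ℕ} (hkn : k ≤ n) :
    Ideal.span {(((Polynomial.X + 1 : ℤ_[p][X]) ^ p ^ n - 1 : ℤ_[p][X]) : PowerSeries ℤ_[p])} ≤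
      Ideal.span {(((Polynomial.X + 1 : ℤ_[p][X]) ^ p ^ k - 1 : ℤ_[p][X]) : PowerSeries ℤ_[p])} := by
  induction n, hkn using Nat.le_induction with
  | base => exact le_rfl
  | succ n _ ih =>
    exact le_trans (Literature.NumberTheory.EllipticCurves.Kato2004.IwasawaH1Exists.span_omega_succ_le p n) ih

/-- ★ **`(1 + T)^β − (1 + T)^{β′} ∈ (ω_k)` when `p^k ∣ β − β′`** (`(1+T)^β = (1+T)^{β′}·(1+T)^{p^k δ}` and
`ω_k ∣ (1+T)^{p^k δ} − 1`, E37). [cite: Washington1997, §7.1–§7.2] -/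
theorem binomialSeries_sub_binomialSeries_mem_span {β β' : ℤ_[p]} {k : ℕ} (h : (p : ℤ_[p]) ^ k ∣ β - β') :
    binomialSeries ℤ_[p] β - binomialSeries ℤ_[p] β' ∈
      Ideal.span {(((Polynomial.X + 1 : ℤ_[p][X]) ^ p ^ k - 1 : ℤ_[p][X]) : PowerSeries ℤ_[p])} := by
  obtain ⟨δ, hδ⟩ := h
  have hβ : β = β' + ((p ^ k : ℕ) : ℤ_[p]) * δ := by rw [Nat.cast_pow, ← hδ]; ring
  have hcoe : (((Polynomial.X + 1 : ℤ_[p][X]) ^ p ^ k - 1 : ℤ_[p][X]) : PowerSeries ℤ_[p]) =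
      ((1 : PowerSeries ℤ_[p]) + PowerSeries.X) ^ p ^ k - 1 := by
    rw [Polynomial.coe_sub, Polynomial.coe_pow, Polynomial.coe_add, Polynomial.coe_X, Polynomial.coe_one, add_comm]
  rw [Ideal.mem_span_singleton, hcoe, hβ, binomialSeries_add,
    show binomialSeries ℤ_[p] β' * binomialSeries ℤ_[p] (((p ^ k : ℕ) : ℤ_[p]) * δ) - binomialSeries ℤ_[p] β' =
      binomialSeries ℤ_[p] β' * (binomialSeries ℤ_[p] (((p ^ k : ℕ) : ℤ_[p]) * δ) - 1) by ring]
  exact dvd_mul_of_dvd_right (pow_sub_one_dvd_binomialSeries_sub_one δ (p ^ k)) _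

/-- ★ **Transfer of representatives**: if `Q` represents `Ψ·(1+T)^{β′}` modulo `ω_n`, `k ≤ n` and `p^k ∣ β − β′`, then `Q`
represents `Ψ·(1+T)^{β}` modulo `ω_k`. [cite: Washington1997, §7.1–§7.2] -/
theorem rep_mul_binomialSeries_of_pow_dvd {Ψ : PowerSeries ℤ_[p]} {Q : ℤ_[p][X]} {β β' : ℤ_[p]} {k n : ℕ} (hkn : k ≤ n)
    (h : (p : ℤ_[p]) ^ k ∣ β - β')
    (hQ : Ψ * binomialSeries ℤ_[p] β' - (Q : PowerSeries ℤ_[p]) ∈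
      Ideal.span {(((Polynomial.X + 1 : ℤ_[p][X]) ^ p ^ n - 1 : ℤ_[p][X]) : PowerSeries ℤ_[p])}) :
    Ψ * binomialSeries ℤ_[p] β - (Q : PowerSeries ℤ_[p]) ∈
      Ideal.span {(((Polynomial.X + 1 : ℤ_[p][X]) ^ p ^ k - 1 : ℤ_[p][X]) : PowerSeries ℤ_[p])} := by
  have e : Ψ * binomialSeries ℤ_[p] β - (Q : PowerSeries ℤ_[p]) =
      Ψ * (binomialSeries ℤ_[p] β - binomialSeries ℤ_[p] β') + (Ψ * binomialSeries ℤ_[p] β' - (Q : PowerSeries ℤ_[p])) := by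
    ring
  rw [e]
  exact Ideal.add_mem _ (Ideal.mul_mem_left _ _ (binomialSeries_sub_binomialSeries_mem_span h)) (span_omega_le hkn hQ)

/-- Transfer of plain representatives to a lower level. [cite: Washington1997, Thm. 7.1] -/
theorem rep_of_le {Ψ : PowerSeries ℤ_[p]} {Q : ℤ_[p][X]} {k n : ℕ} (hkn : k ≤ n)
    (hQ : Ψ - (Q : PowerSeries ℤ_[p]) ∈
      Ideal.span {(((Polynomial.X + 1 : ℤ_[p][X]) ^ p ^ n - 1 : ℤ_[p][X]) : PowerSeries ℤ_[p])}) :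
    Ψ - (Q : PowerSeries ℤ_[p]) ∈
      Ideal.span {(((Polynomial.X + 1 : ℤ_[p][X]) ^ p ^ k - 1 : ℤ_[p][X]) : PowerSeries ℤ_[p])} :=
  span_omega_le hkn hQ

/-! ## §3 The algebra of the level identity after the dictionary -/

/-- ★ **From (★χ) and the readings to `e • Q₁(u − 1) = Q₂(u − 1)`**: in the commutative `ℚ_p`-algebra `ℚ_p ⊗_ℚ ℂ`, if
`r_F(u−1)·(e • T₁) = r_G(u−1)·(W·T₂)`, `p^{v₁} • T₁ = R₁(u−1)`, `p^{v₂} • T₂ = R₂(u−1)` and `W = r_a(u−1)`, then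
`e • (p^{v₂} r_F R₁)(u−1) = (p^{v₁} r_G R₂ r_a)(u−1)`. [cite: Kato2004Asterisque, §13.9 (p. 230)] -/
theorem smul_aeval_eq_aeval_of_reads {u T₁ T₂ W : ℚ_[p] ⊗[ℚ] ℂ} {rF rG R₁ R₂ ra : ℤ_[p][X]} {e : ℚ_[p]} {v₁ v₂ : ℕ}
    (hstar : aeval (u - 1) rF * (e • T₁) = aeval (u - 1) rG * (W * T₂))
    (h₁ : ((p : ℚ_[p]) ^ v₁) • T₁ = aeval (u - 1) R₁) (h₂ : ((p : ℚ_[p]) ^ v₂) • T₂ = aeval (u - 1) R₂)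
    (ha : W = aeval (u - 1) ra) :
    e • aeval (u - 1) (Polynomial.C ((p : ℤ_[p]) ^ v₂) * rF * R₁) =
      aeval (u - 1) (Polynomial.C ((p : ℤ_[p]) ^ v₁) * rG * R₂ * ra) := by
  have hc : ∀ v : ℕ, (algebraMap ℤ_[p] (ℚ_[p] ⊗[ℚ] ℂ)) ((p : ℤ_[p]) ^ v) =
      algebraMap ℚ_[p] (ℚ_[p] ⊗[ℚ] ℂ) ((p : ℚ_[p]) ^ v) := fun v => by
    rw [IsScalarTower.algebraMap_apply ℤ_[p] ℚ_[p] (ℚ_[p] ⊗[ℚ] ℂ), map_pow, map_natCast, map_pow, map_natCast]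
  rw [map_mul, map_mul, map_mul, map_mul, map_mul, Polynomial.aeval_C, Polynomial.aeval_C, hc, hc, ← h₁, ← h₂, ← ha,
    Algebra.smul_def, Algebra.smul_def, Algebra.smul_def]
  rw [Algebra.smul_def] at hstar
  linear_combination (algebraMap ℚ_[p] (ℚ_[p] ⊗[ℚ] ℂ) ((p : ℚ_[p]) ^ v₁) *
    algebraMap ℚ_[p] (ℚ_[p] ⊗[ℚ] ℂ) ((p : ℚ_[p]) ^ v₂)) * hstar

end Summit.BirchSwinnertonDyer.Rank1Residual.Additive.PerrinRiouUnit

end
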